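import Summits.HodgeConjecture.CorCM.SexticOcticWeilHodgeOfMarkman
import HarnessLib

/-!
# COR-CM — JOINT TRANSITIVITY is automatic for a sextic and an octic CM field through `k` (coprime relative degrees `3`, `4`): the Hodge
# conjecture for all `E^a × T^n × B^m` modulo Markman's fourfold and hyperbolic-sixfold theorems with NO hypothesis on the fields

Cell `pub-hodgecm2` (COR-CM), seat b30 gen 26 (2026-08-23); count-neutral own lane SEXTIC-OCTIC — the capstone of the chain
`Census/SexticOcticWeil*` + `CorCM/SexticOcticWeil*`.  Theorems only; no definition, no named fact, no `sorry`.  HONEST FRAMING: a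
CONDITIONAL result for a NAMED class of CM abelian varieties; `HC_CM` is NOT proved and is not mentioned; displayed deep inputs = the two
Markman facts only.

THE ARGUMENT (a counting lemma, no field theory beyond transitivity on ONE fibre).  Let `X`, `Y` be finite sets of coprime sizes and
`R ⊆ Sym(X) × Sym(Y)` a set of pairs closed under products and inverses whose two projections act TRANSITIVELY.  The orbit `O ⊆ X × Y` of a
point under `R` maps onto `X` with fibres of one size (they are permuted by `R`), so `|X|` divides `|O|`; likewise `|Y|` divides `|O|`;
hence `|X|·|Y|` divides `|O| ≤ |X|·|Y|` and `O = X × Y` (**`exists_mem_pair_of_coprime`**).  For a sextic `K₁ ⊇ i₁(k)` and an octic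
`K₂ ⊇ i₂(k)` take `X`, `Y` = the embeddings over `τ` (`3` and `4` of them, `card_filter_comp_eq_of_finrank`) and `R` = the pairs of
permutations induced by the automorphisms of `ℂ` fixing `τ`; each projection is transitive because `Aut(ℂ)` is transitive on the
embeddings of a number field (`ZarhinLie.exists_ringEquiv_complex_comp_eq`) and an automorphism matching two embeddings over `τ` fixes
`τ`.  Hence **`exists_ringEquiv_comp_eq_pair`**: any two pairs `(x, y)`, `(x', y')` of embeddings of `(K₁, K₂)` over `τ` are related by ONE
automorphism of `ℂ` — the hypothesis `hJT` of `hodgeConjectureFor_biproduct_comp_vec_of_markman` — and the HEADLINE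
**`hodgeConjectureFor_biproduct_comp_vec_of_markman'`**: `k` imaginary quadratic, `K₁ ∋ k` ANY sextic CM field, `K₂ ∋ k` ANY octic CM
field, `T` a CM threefold over `K₁` of `k`-signature `(1,2)`, `B` a CM fourfold over `K₂` of `k`-signature `(1,3)`, `E` the CM curve of
`k`: the Hodge conjecture for EVERY `E^a × T^n × B^m` (and everything dominated), GIVEN ONLY Markman's two theorems.
[cite: DixonMortimer1996, §1.6 and §2.1] [cite: Markman2025SurveySecant, Thm. 1.2] [cite: Markman2025SecantWeil, Thm 1.5.1]
[cite: MumfordAV1970, §19]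

## References
* [DixonMortimer1996] J. D. Dixon, B. Mortimer, *Permutation Groups*, GTM 163, §1.6, §2.1.  [Markman2025SurveySecant] E. Markman,
  arXiv:2509.23403, Thm. 1.2.  [Markman2025SecantWeil] E. Markman, arXiv:2502.03415, Thm. 1.5.1.  [MumfordAV1970] D. Mumford, *Abelian
  Varieties*, §19.
-/

noncomputable section

open CategoryTheory CategoryTheory.Limits NumberField

namespace Summit.HodgeConjecture.CorCM.SexticOcticWeil

open Literature.AlgebraicGeometry Literature.AlgebraicGeometry.Motives Literature.AlgebraicGeometry.HodgeTheory
open Literature.AlgebraicGeometry.ComplexMultiplication (IsCMTypeRealisation)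
open Literature.AlgebraicTopology.SingularHomology

open scoped Classical

/-! ## §1 The counting lemma: transitive projections and coprime sizes force joint transitivity -/

section Counting

variable {X Y : Type*} [Fintype X] [Fintype Y]

/-- **Joint transitivity from coprime sizes.**  `R ⊆ Sym(X) × Sym(Y)` closed under products and inverses, each projection transitive,
`|X|`, `|Y|` coprime: for all `x₀ x y₀ y` some `π ∈ R` has `π.1 x = x₀` AND `π.2 y = y₀` (module docstring: every fibre of the orbit of
`(x₀, y₀)` over `X` has the same size, so `|X| · f = |Y| · g = |orbit|`, and coprimality gives `f = |Y|`). [cite: DixonMortimer1996, §1.6] -/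
theorem exists_mem_pair_of_coprime (hXY : (Fintype.card X).Coprime (Fintype.card Y)) (R : Set (Equiv.Perm X × Equiv.Perm Y))
    (hmul : ∀ π ∈ R, ∀ π' ∈ R, π * π' ∈ R) (hinv : ∀ π ∈ R, π⁻¹ ∈ R)
    (hX : ∀ x x' : X, ∃ π ∈ R, π.1 x = x') (hY : ∀ y y' : Y, ∃ π ∈ R, π.2 y = y') (x₀ x : X) (y₀ y : Y) :
    ∃ π ∈ R, π.1 x = x₀ ∧ π.2 y = y₀ := by
  -- the orbit condition and its fibres
  let P : X → Y → Prop := fun x y => ∃ π ∈ R, π.1 x = x₀ ∧ π.2 y = y₀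
  let S : X → Finset Y := fun x => Finset.univ.filter fun y => P x y
  let T : Y → Finset X := fun y => Finset.univ.filter fun x => P x y
  -- moving along `R` inside the orbit
  have hmove : ∀ (σ : Equiv.Perm X × Equiv.Perm Y), σ ∈ R → ∀ x y, P x y → P (σ.1 x) (σ.2 y) := by
    rintro σ hσ x y ⟨π, hπ, hx, hy⟩
    refine ⟨π * σ⁻¹, hmul π hπ _ (hinv σ hσ), ?_, ?_⟩
    · change π.1 (σ.1⁻¹ (σ.1 x)) = x₀; rw [Equiv.Perm.inv_def, Equiv.symm_apply_apply, hx]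
    · change π.2 (σ.2⁻¹ (σ.2 y)) = y₀; rw [Equiv.Perm.inv_def, Equiv.symm_apply_apply, hy]
  -- the fibres over `X` have one size
  have hSle : ∀ x x', (S x).card ≤ (S x').card := by
    intro x x'
    obtain ⟨σ, hσ, hσx⟩ := hX x x'
    refine Finset.card_le_card_of_injOn (fun y => σ.2 y) (fun y hy => ?_) fun y _ y' _ h => σ.2.injective h
    have hy' : P x y := (Finset.mem_filter.1 hy).2
    have h := hmove σ hσ x y hy'
    rw [hσx] at h
    exact Finset.mem_filter.2 ⟨Finset.mem_univ _, h⟩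
  have hS : ∀ x, (S x).card = (S x₀).card := fun x => le_antisymm (hSle x x₀) (hSle x₀ x)
  -- the fibres over `Y` have one size
  have hTle : ∀ y y', (T y).card ≤ (T y').card := by
    intro y y'
    obtain ⟨σ, hσ, hσy⟩ := hY y y'
    refine Finset.card_le_card_of_injOn (fun x => σ.1 x) (fun x hx => ?_) fun x _ x' _ h => σ.1.injective h
    have hx' : P x y := (Finset.mem_filter.1 hx).2
    have h := hmove σ hσ x y hx'
    rw [hσy] at h
    exact Finset.mem_filter.2 ⟨Finset.mem_univ _, h⟩
  have hT : ∀ y, (T y).card = (T y₀).card := fun y => le_antisymm (hTle y y₀) (hTle y₀ y)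
  -- double counting: `|X| · f = |Y| · g`
  have hdouble : ∑ x, (S x).card = ∑ y, (T y).card := by
    simp only [S, T, Finset.card_filter]
    exact Finset.sum_comm
  rw [Finset.sum_congr rfl fun x _ => hS x, Finset.sum_congr rfl fun y _ => hT y, Finset.sum_const, Finset.sum_const,
    Finset.card_univ, Finset.card_univ, smul_eq_mul, smul_eq_mul] at hdouble
  -- `(x₀, y₀)` is in the orbit (`1 ∈ R`), so the fibres are non-empty
  have hone : (1 : Equiv.Perm X × Equiv.Perm Y) ∈ R := by
    obtain ⟨π, hπ, -⟩ := hX x₀ x₀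
    have h := hmul π hπ _ (hinv π hπ)
    rwa [mul_inv_cancel] at h
  have hpos : 0 < (S x₀).card :=
    Finset.card_pos.2 ⟨y₀, Finset.mem_filter.2 ⟨Finset.mem_univ _, 1, hone, rfl, rfl⟩⟩
  -- coprimality: `|Y|` divides `f ≤ |Y|`, so `f = |Y|`
  have hdvd : Fintype.card Y ∣ Fintype.card X * (S x₀).card := ⟨(T y₀).card, hdouble⟩
  have hdvd' : Fintype.card Y ∣ (S x₀).card := (Nat.Coprime.symm hXY).dvd_of_dvd_mul_left hdvd
  have hle : (S x₀).card ≤ Fintype.card Y := Finset.card_le_univ _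
  have hcard : (S x).card = Fintype.card Y := by rw [hS x]; exact le_antisymm hle (Nat.le_of_dvd hpos hdvd')
  have hmem : y ∈ S x := by rw [Finset.eq_univ_of_card (S x) hcard]; exact Finset.mem_univ y
  exact (Finset.mem_filter.1 hmem).2

end Counting

/-! ## §2 A sextic and an octic field through `k`: one automorphism of `ℂ` moves any pair of embeddings over `τ` to any other -/

section Fields

variable {k K₁ K₂ : Type} [Field k] [NumberField k] [Field K₁] [NumberField K₁] [Field K₂] [NumberField K₂]

omit [NumberField k] in
/-- The self-map of the `τ`-fibre induced by an automorphism of `ℂ` fixing `τ`, as a permutation. [cite: Shimura1998, §18.2 Lemma (i)] -/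
private theorem exists_perm_fibre {K : Type} [Field K] [NumberField K] (i : k →+* K) (τ : k →+* ℂ) (ρ : ℂ ≃+* ℂ)
    (hρ : (ρ : ℂ →+* ℂ).comp τ = τ) :
    ∃ π : Equiv.Perm {s : K →+* ℂ // s.comp i = τ}, ∀ s, ((π s) : K →+* ℂ) = (ρ : ℂ →+* ℂ).comp s.1 := by
  have hover : ∀ s : {s : K →+* ℂ // s.comp i = τ}, ((ρ : ℂ →+* ℂ).comp s.1).comp i = τ := fun s => by
    rw [RingHom.comp_assoc, s.2, hρ]
  let f : {s : K →+* ℂ // s.comp i = τ} → {s : K →+* ℂ // s.comp i = τ} := fun s => ⟨_, hover s⟩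
  have hfinj : Function.Injective f := fun s s' h =>
    Subtype.ext (OcticCurveFourfold.comp_injective (K := K) ρ (congrArg Subtype.val h))
  exact ⟨Equiv.ofBijective f (Finite.injective_iff_bijective.1 hfinj), fun s => rfl⟩

/-- **JOINT TRANSITIVITY for a sextic and an octic CM field through `k`.**  `[k:ℚ] = 2`, `[K₁:ℚ] = 6`, `[K₂:ℚ] = 8`, `i₁ : k → K₁`,
`i₂ : k → K₂`: for embeddings `x, x'` of `K₁` and `y, y'` of `K₂` over `τ`, ONE automorphism `ρ` of `ℂ` has `ρ ∘ x = x'` and `ρ ∘ y = y'`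
(§1 with `|X| = 3`, `|Y| = 4`; each projection transitive by `ZarhinLie.exists_ringEquiv_complex_comp_eq`).
[cite: DixonMortimer1996, §1.6 and §2.1] [cite: Shimura1998, §18.2 Lemma (i)] -/
theorem exists_ringEquiv_comp_eq_pair (h2 : Module.finrank ℚ k = 2) (h6 : Module.finrank ℚ K₁ = 6) (h8 : Module.finrank ℚ K₂ = 8)
    (i₁ : k →+* K₁) (i₂ : k →+* K₂) {τ : k →+* ℂ} (x x' : K₁ →+* ℂ) (y y' : K₂ →+* ℂ)
    (hx : x.comp i₁ = τ) (hx' : x'.comp i₁ = τ) (hy : y.comp i₂ = τ) (hy' : y'.comp i₂ = τ) :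
    ∃ ρ : ℂ ≃+* ℂ, (ρ : ℂ →+* ℂ).comp x = x' ∧ (ρ : ℂ →+* ℂ).comp y = y' := by
  haveI : Countable K₁ := Countable.of_equiv _ (Module.finBasis ℚ K₁).equivFun.toEquiv.symm
  haveI : Countable K₂ := Countable.of_equiv _ (Module.finBasis ℚ K₂).equivFun.toEquiv.symm
  -- the two fibres and their sizes
  let X := {s : K₁ →+* ℂ // s.comp i₁ = τ}
  let Y := {t : K₂ →+* ℂ // t.comp i₂ = τ}
  have hcX : Fintype.card X = 3 := by rw [Fintype.card_subtype]; exact card_filter_comp_eq_of_finrank (n := 3) i₁ h6 h2 τ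
  have hcY : Fintype.card Y = 4 := by rw [Fintype.card_subtype]; exact card_filter_comp_eq_of_finrank (n := 4) i₂ h8 h2 τ
  have hXY : (Fintype.card X).Coprime (Fintype.card Y) := by rw [hcX, hcY]; decide
  -- the realised pairs of permutations of the two fibres
  let R : Set (Equiv.Perm X × Equiv.Perm Y) := {π | ∃ ρ : ℂ ≃+* ℂ,
    (∀ s : X, ((π.1 s) : K₁ →+* ℂ) = (ρ : ℂ →+* ℂ).comp s.1) ∧ ∀ t : Y, ((π.2 t) : K₂ →+* ℂ) = (ρ : ℂ →+* ℂ).comp t.1}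
  have hmul : ∀ π ∈ R, ∀ π' ∈ R, π * π' ∈ R := by
    rintro π ⟨ρ, h₁, h₂⟩ π' ⟨ρ', h₁', h₂'⟩
    refine ⟨ρ'.trans ρ, fun s => ?_, fun t => ?_⟩
    · change ((π.1 (π'.1 s)) : K₁ →+* ℂ) = _
      rw [h₁, h₁', RingEquiv.coe_ringHom_trans, RingHom.comp_assoc]
    · change ((π.2 (π'.2 t)) : K₂ →+* ℂ) = _
      rw [h₂, h₂', RingEquiv.coe_ringHom_trans, RingHom.comp_assoc]
  have hinv : ∀ π ∈ R, π⁻¹ ∈ R := by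
    rintro π ⟨ρ, h₁, h₂⟩
    have hid : ((ρ.symm : ℂ ≃+* ℂ) : ℂ →+* ℂ).comp (ρ : ℂ →+* ℂ) = RingHom.id ℂ := RingHom.ext fun z => ρ.symm_apply_apply z
    refine ⟨ρ.symm, fun s => ?_, fun t => ?_⟩
    · have h := h₁ (π.1⁻¹ s)
      rw [Equiv.Perm.inv_def, Equiv.apply_symm_apply] at h
      change ((π.1⁻¹ s) : K₁ →+* ℂ) = _
      rw [Equiv.Perm.inv_def, h, ← RingHom.comp_assoc, hid, RingHom.id_comp]
    · have h := h₂ (π.2⁻¹ t)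
      rw [Equiv.Perm.inv_def, Equiv.apply_symm_apply] at h
      change ((π.2⁻¹ t) : K₂ →+* ℂ) = _
      rw [Equiv.Perm.inv_def, h, ← RingHom.comp_assoc, hid, RingHom.id_comp]
  -- an automorphism fixing `τ` gives a member of `R`
  have hmemR : ∀ ρ : ℂ ≃+* ℂ, (ρ : ℂ →+* ℂ).comp τ = τ → ∃ π ∈ R,
      (∀ s : X, ((π.1 s) : K₁ →+* ℂ) = (ρ : ℂ →+* ℂ).comp s.1) ∧ ∀ t : Y, ((π.2 t) : K₂ →+* ℂ) = (ρ : ℂ →+* ℂ).comp t.1 := by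
    intro ρ hρ
    obtain ⟨π₁, hπ₁⟩ := exists_perm_fibre i₁ τ ρ hρ
    obtain ⟨π₂, hπ₂⟩ := exists_perm_fibre i₂ τ ρ hρ
    exact ⟨(π₁, π₂), ⟨ρ, hπ₁, hπ₂⟩, hπ₁, hπ₂⟩
  -- each projection is transitive
  have hXt : ∀ s s' : X, ∃ π ∈ R, π.1 s = s' := by
    intro s s'
    obtain ⟨ρ, hρ⟩ := Motives.ZarhinLie.exists_ringEquiv_complex_comp_eq s.1 s'.1
    have hρs : (ρ : ℂ →+* ℂ).comp s.1 = s'.1 := RingHom.ext fun a => hρ a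
    have hρτ : (ρ : ℂ →+* ℂ).comp τ = τ := by rw [← s.2, ← RingHom.comp_assoc, hρs]; exact s'.2.trans s.2.symm
    obtain ⟨π, hπ, h₁, -⟩ := hmemR ρ hρτ
    exact ⟨π, hπ, Subtype.ext ((h₁ s).trans hρs)⟩
  have hYt : ∀ t t' : Y, ∃ π ∈ R, π.2 t = t' := by
    intro t t'
    obtain ⟨ρ, hρ⟩ := Motives.ZarhinLie.exists_ringEquiv_complex_comp_eq t.1 t'.1
    have hρt : (ρ : ℂ →+* ℂ).comp t.1 = t'.1 := RingHom.ext fun a => hρ a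
    have hρτ : (ρ : ℂ →+* ℂ).comp τ = τ := by rw [← t.2, ← RingHom.comp_assoc, hρt]; exact t'.2.trans t.2.symm
    obtain ⟨π, hπ, -, h₂⟩ := hmemR ρ hρτ
    exact ⟨π, hπ, Subtype.ext ((h₂ t).trans hρt)⟩
  -- the counting lemma
  obtain ⟨π, ⟨ρ, h₁, h₂⟩, hπx, hπy⟩ :=
    exists_mem_pair_of_coprime hXY R hmul hinv hXt hYt (⟨x', hx'⟩ : X) ⟨x, hx⟩ (⟨y', hy'⟩ : Y) ⟨y, hy⟩
  refine ⟨ρ, ?_, ?_⟩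
  · have h := h₁ ⟨x, hx⟩
    rw [hπx] at h
    exact h.symm
  · have h := h₂ ⟨y, hy⟩
    rw [hπy] at h
    exact h.symm

end Fields

/-! ## §3 The headline: no hypothesis on the two fields -/

section Headline

variable {k K₁ K₂ : Type} [Field k] [NumberField k] [IsCMField k] [Field K₁] [NumberField K₁] [IsCMField K₁]
  [Field K₂] [NumberField K₂] [IsCMField K₂] {N : ℕ}
  {E T B : AbelianVariety ℂ} {Ψ : CMType k} {Φ₁ : CMType K₁} {Φ₂ : CMType K₂}
  {ιE : 𝓞 k →+* End E} {θE : k →+* Module.End ℂ (complexBetti E.X 1)}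
  {ιT : 𝓞 K₁ →+* End T} {θT : K₁ →+* Module.End ℂ (complexBetti T.X 1)}
  {ιB : 𝓞 K₂ →+* End B} {θB : K₂ →+* Module.End ℂ (complexBetti B.X 1)}

/-- **HEADLINE.  The Hodge conjecture for every product of copies of `E`, `T`, `B` — `E^a × T^n × B^m`, all exponents, any order — GIVEN ONLY
Markman's fourfold theorem and hyperbolic-sixfold theorem, with NO hypothesis on the fields**: `k` an imaginary quadratic field, `K₁ ⊇ i₁(k)`
ANY sextic CM field, `K₂ ⊇ i₂(k)` ANY octic CM field, `E ⊨ (k; Ψ)` a CM elliptic curve (`τ ∈ Ψ`), `T ⊨ (K₁; Φ₁)` a CM abelian threefold of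
`k`-signature `(1,2)` (exactly one member of `Φ₁` over `τ`), `B ⊨ (K₂; Φ₂)` a CM abelian fourfold of `k`-signature `(1,3)`.  The Hodge rings
of these products contain the Weil classes of the FOURFOLD `T × E`, the SIXFOLD `B × E × E`, the EIGHTFOLD `Ē × T × B̄` and the TENFOLD
`T × T × B̄` — the exceptional classes forced by the shared imaginary quadratic field (b23's `exists_exceptional_prod_of_shared_imaginary_
quadratic`, b16's `exists_exceptional_prod_iff_threefold_fourfold`) — all algebraic modulo the two facts.  `HC_CM` is NOT asserted.
[cite: Markman2025SurveySecant, Thm. 1.2] [cite: Markman2025SecantWeil, Thm 1.5.1] [cite: Pohlmann1968, Thm 1] -/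
theorem hodgeConjectureFor_biproduct_comp_vec_of_markman'
    (hW4 : Markman2025_weilClasses_algebraic_abelianFourfold) (hM6 : Markman2025_weilClasses_algebraic_hyperbolicSixfold)
    (h2 : Module.finrank ℚ k = 2) (h6 : Module.finrank ℚ K₁ = 6) (h8 : Module.finrank ℚ K₂ = 8) (i₁ : k →+* K₁) (i₂ : k →+* K₂)
    (hE : IsCMTypeRealisation Ψ E ιE θE) (hT : IsCMTypeRealisation Φ₁ T ιT θT) (hB : IsCMTypeRealisation Φ₂ B ιB θB)
    {τ : k →+* ℂ} (hτΨ : τ ∈ Ψ.1)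
    (h12 : (Finset.univ.filter fun s : K₁ →+* ℂ => s.comp i₁ = τ ∧ s ∈ Φ₁.1).card = 1)
    (h13 : (Finset.univ.filter fun t : K₂ →+* ℂ => t.comp i₂ = τ ∧ t ∈ Φ₂.1).card = 1) (κ : Fin N → Fin 3) :
    HodgeConjectureFor (⨁ fun j => (![E, T, B] : Fin 3 → AbelianVariety ℂ) (κ j)).dim
      (⨁ fun j => (![E, T, B] : Fin 3 → AbelianVariety ℂ) (κ j)).X :=
  hodgeConjectureFor_biproduct_comp_vec_of_markman hW4 hM6 h2 h6 h8 i₁ i₂ hE hT hB hτΨ h12 h13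
    (fun x x' y y' hx hx' hy hy' => exists_ringEquiv_comp_eq_pair h2 h6 h8 i₁ i₂ x x' y y' hx hx' hy hy') κ

/-- **Everything dominated by a product of copies of `E`, `T`, `B`** — abelian subvarieties, quotients, isogeny images of the
`E^a × T^n × B^m` — satisfies the Hodge conjecture, GIVEN ONLY Markman's two theorems (no hypothesis on the fields).
[cite: Markman2025SurveySecant, Thm. 1.2] [cite: Markman2025SecantWeil, Thm 1.5.1] [cite: MumfordAV1970, §19] -/
theorem hodgeConjectureFor_of_avDominatedBy_comp_vec_of_markman'
    (hW4 : Markman2025_weilClasses_algebraic_abelianFourfold) (hM6 : Markman2025_weilClasses_algebraic_hyperbolicSixfold)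
    (h2 : Module.finrank ℚ k = 2) (h6 : Module.finrank ℚ K₁ = 6) (h8 : Module.finrank ℚ K₂ = 8) (i₁ : k →+* K₁) (i₂ : k →+* K₂)
    (hE : IsCMTypeRealisation Ψ E ιE θE) (hT : IsCMTypeRealisation Φ₁ T ιT θT) (hB : IsCMTypeRealisation Φ₂ B ιB θB)
    {τ : k →+* ℂ} (hτΨ : τ ∈ Ψ.1)
    (h12 : (Finset.univ.filter fun s : K₁ →+* ℂ => s.comp i₁ = τ ∧ s ∈ Φ₁.1).card = 1)
    (h13 : (Finset.univ.filter fun t : K₂ →+* ℂ => t.comp i₂ = τ ∧ t ∈ Φ₂.1).card = 1) (κ : Fin N → Fin 3)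
    {X : AbelianVariety ℂ} (hX : Domination.AVDominatedBy X (⨁ fun j => (![E, T, B] : Fin 3 → AbelianVariety ℂ) (κ j))) :
    HodgeConjectureFor X.dim X.X :=
  Domination.hodgeConjectureFor_of_avDominatedBy
    (hodgeConjectureFor_biproduct_comp_vec_of_markman' hW4 hM6 h2 h6 h8 i₁ i₂ hE hT hB hτΨ h12 h13 κ) hX

end Headline

/-! ## §4 The conjugate signatures `(2,1)` and `(3,1)`: conjugate CM structures on `T` and on `B` -/

section Signatures

variable {k K₁ K₂ : Type} [Field k] [NumberField k] [IsCMField k] [Field K₁] [NumberField K₁] [IsCMField K₁]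
  [Field K₂] [NumberField K₂] [IsCMField K₂] {N : ℕ}
  {E T B : AbelianVariety ℂ} {Ψ : CMType k} {Φ₁ : CMType K₁} {Φ₂ : CMType K₂}
  {ιE : 𝓞 k →+* End E} {θE : k →+* Module.End ℂ (complexBetti E.X 1)}
  {ιT : 𝓞 K₁ →+* End T} {θT : K₁ →+* Module.End ℂ (complexBetti T.X 1)}
  {ιB : 𝓞 K₂ →+* End B} {θB : K₂ →+* Module.End ℂ (complexBetti B.X 1)}

omit [NumberField k] [IsCMField k] in
/-- **The conjugate type counts the complement over `τ`**: for the type `Φ^c` transported along complex conjugation `c` of the CM field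
`K` (`s ∈ Φ^c ⟺ s̄ ∈ Φ ⟺ s ∉ Φ`), `#{s ∈ Φ^c | s ∘ i = τ} = #{s | s ∘ i = τ} − #{s ∈ Φ | s ∘ i = τ}`. [cite: Shimura1998, §18.2 Lemma (i)] -/
theorem card_filter_cmTypeMap_complexConj {K : Type} [Field K] [NumberField K] [IsCMField K] (i : k →+* K) (τ : k →+* ℂ)
    (Φ : CMType K) :
    (Finset.univ.filter fun s : K →+* ℂ => s.comp i = τ ∧
        s ∈ (Literature.NumberTheory.Automorphic.PicardCM.CMCode.cmTypeMap (IsCMField.complexConj K).toRingEquiv Φ).1).card =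
      (Finset.univ.filter fun s : K →+* ℂ => s.comp i = τ).card -
        (Finset.univ.filter fun s : K →+* ℂ => s.comp i = τ ∧ s ∈ Φ.1).card := by
  have hmem : ∀ s : K →+* ℂ,
      s ∈ (Literature.NumberTheory.Automorphic.PicardCM.CMCode.cmTypeMap (IsCMField.complexConj K).toRingEquiv Φ).1 ↔ s ∉ Φ.1 := by
    intro s
    rw [Literature.NumberTheory.Automorphic.PicardCM.CMCode.mem_cmTypeMap_iff]
    have hc : s.comp (IsCMField.complexConj K).toRingEquiv.toRingHom = ComplexEmbedding.conjugate s :=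
      RingHom.ext fun x => IsCMField.complexEmbedding_complexConj K s x
    rw [hc, Φ.2 s, not_not]
  have hsplit := Finset.card_filter_add_card_filter_not (s := Finset.univ.filter fun s : K →+* ℂ => s.comp i = τ) (fun s => s ∈ Φ.1)
  rw [Finset.filter_filter, Finset.filter_filter] at hsplit
  rw [Finset.filter_congr fun s _ => show (s.comp i = τ ∧ s ∈ (Literature.NumberTheory.Automorphic.PicardCM.CMCode.cmTypeMap
      (IsCMField.complexConj K).toRingEquiv Φ).1) ↔ (s.comp i = τ ∧ s ∉ Φ.1) by rw [hmem s]]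
  omega

/-- **ALL FOUR SIGN COMBINATIONS.**  The headline `hodgeConjectureFor_biproduct_comp_vec_of_markman'` with `T` of `k`-signature `(1,2)` OR
`(2,1)` and `B` of `k`-signature `(1,3)` OR `(3,1)`: a structure with `2` (resp. `3`) members over `τ` is replaced by the CONJUGATE CM
structure on the SAME variety (`IsCMTypeRealisation.transport` along complex conjugation of `K₁`, resp. `K₂`), which realises the conjugate
type with `3 − 2 = 1` (resp. `4 − 3 = 1`) member over `τ`; the abelian varieties, hence the conclusion, are unchanged.
[cite: Markman2025SurveySecant, Thm. 1.2] [cite: Markman2025SecantWeil, Thm 1.5.1] [cite: Shimura1998, §18.2 Lemma (i)] -/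
theorem hodgeConjectureFor_biproduct_comp_vec_of_markman_of_signs
    (hW4 : Markman2025_weilClasses_algebraic_abelianFourfold) (hM6 : Markman2025_weilClasses_algebraic_hyperbolicSixfold)
    (h2 : Module.finrank ℚ k = 2) (h6 : Module.finrank ℚ K₁ = 6) (h8 : Module.finrank ℚ K₂ = 8) (i₁ : k →+* K₁) (i₂ : k →+* K₂)
    (hE : IsCMTypeRealisation Ψ E ιE θE) (hT : IsCMTypeRealisation Φ₁ T ιT θT) (hB : IsCMTypeRealisation Φ₂ B ιB θB)
    {τ : k →+* ℂ} (hτΨ : τ ∈ Ψ.1)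
    (h12 : (Finset.univ.filter fun s : K₁ →+* ℂ => s.comp i₁ = τ ∧ s ∈ Φ₁.1).card = 1 ∨
      (Finset.univ.filter fun s : K₁ →+* ℂ => s.comp i₁ = τ ∧ s ∈ Φ₁.1).card = 2)
    (h13 : (Finset.univ.filter fun t : K₂ →+* ℂ => t.comp i₂ = τ ∧ t ∈ Φ₂.1).card = 1 ∨
      (Finset.univ.filter fun t : K₂ →+* ℂ => t.comp i₂ = τ ∧ t ∈ Φ₂.1).card = 3) (κ : Fin N → Fin 3) :
    HodgeConjectureFor (⨁ fun j => (![E, T, B] : Fin 3 → AbelianVariety ℂ) (κ j)).dim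
      (⨁ fun j => (![E, T, B] : Fin 3 → AbelianVariety ℂ) (κ j)).X := by
  have hn₁ := card_filter_comp_eq_of_finrank (n := 3) i₁ h6 h2 τ
  have hn₂ := card_filter_comp_eq_of_finrank (n := 4) i₂ h8 h2 τ
  -- normalise `T` to one member over `τ`
  have hT' : ∃ (Φ₁' : CMType K₁) (ιT' : 𝓞 K₁ →+* End T) (θT' : K₁ →+* Module.End ℂ (complexBetti T.X 1)),
      IsCMTypeRealisation Φ₁' T ιT' θT' ∧ (Finset.univ.filter fun s : K₁ →+* ℂ => s.comp i₁ = τ ∧ s ∈ Φ₁'.1).card = 1 := by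
    rcases h12 with h | h
    · exact ⟨Φ₁, ιT, θT, hT, h⟩
    · refine ⟨_, _, _, hT.transport (IsCMField.complexConj K₁).toRingEquiv, ?_⟩
      rw [card_filter_cmTypeMap_complexConj i₁ τ Φ₁, hn₁, h]
  -- normalise `B` to one member over `τ`
  have hB' : ∃ (Φ₂' : CMType K₂) (ιB' : 𝓞 K₂ →+* End B) (θB' : K₂ →+* Module.End ℂ (complexBetti B.X 1)),
      IsCMTypeRealisation Φ₂' B ιB' θB' ∧ (Finset.univ.filter fun t : K₂ →+* ℂ => t.comp i₂ = τ ∧ t ∈ Φ₂'.1).card = 1 := by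
    rcases h13 with h | h
    · exact ⟨Φ₂, ιB, θB, hB, h⟩
    · refine ⟨_, _, _, hB.transport (IsCMField.complexConj K₂).toRingEquiv, ?_⟩
      rw [card_filter_cmTypeMap_complexConj i₂ τ Φ₂, hn₂, h]
  obtain ⟨Φ₁', ιT', θT', hT'', h12'⟩ := hT'
  obtain ⟨Φ₂', ιB', θB', hB'', h13'⟩ := hB'
  exact hodgeConjectureFor_biproduct_comp_vec_of_markman' hW4 hM6 h2 h6 h8 i₁ i₂ hE hT'' hB'' hτΨ h12' h13' κ

end Signatures

end Summit.HodgeConjecture.CorCM.SexticOcticWeil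

end
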